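import Mathlib
import HarnessLib

/-!
# Route `ColdStartUniversality` (fixed-cut-off package): kernel-action continuity toolkit for the reversibility of the
# SZZ dynamics — uniform continuity from joint continuity, jointly continuous Markov-kernel actions, Fubini on the
# 2-simplex and the shear substitution

Helper file (seat `ym-line-csu-p1`, g15).  ABSTRACT topology / measure theory on a compact space `X`, no SZZ object.  These
are the bookkeeping lemmas of the Duhamel → second-Duhamel → symmetry argument proving that the Shen–Zhu–Zhu lattice
Langevin semigroup is REVERSIBLE (self-adjoint on `L²`) with respect to the Wilson measure (SZZ, CMP 400 (2023) §3, p. 13: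
«`(P_t^L)` is a `μ`-version of the `L²(μ)`-semigroup associated with the Dirichlet form `𝓔^L`», stated there without proof):

* `tendstoUniformly_of_continuous_uncurry`: a jointly continuous `F : P × Y → ℝ` with `Y` compact is continuous into the
  sup-norm (tube lemma, via `ContinuousMap.curry`);
* `continuous_kernel_action_comp`: if the action `(s, x) ↦ ∫ G d(κ s x)` of a Markov-kernel family is jointly continuous for
  every continuous `G`, then `(s, p, x) ↦ ∫ G_p d(κ s x)` is jointly continuous for every jointly continuous family `G_p`;
* `integral_intervalIntegral_swap_of_continuous`: `∫ (∫ₐᵇ G u y du) dν(y) = ∫ₐᵇ ∫ G u y dν(y) du` for jointly continuous `G`;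
* `intervalIntegral_triangle_swap`: `∫₀ᵗ ∫₀ʳ f r u du dr = ∫₀ᵗ ∫ᵤᵗ f r u dr du` (Fubini on the 2-simplex);
* `intervalIntegral_shear`: `∫₀ᵗ ∫₀ʳ h (t-r) u (r-u) du dr = ∫₀ᵗ ∫₀ˢ h (s-u) u (t-s) du ds` (the measure-preserving shear
  `(r, u) ↦ (t - r + u, u)` of the simplex, which exchanges the two Duhamel (variation-of-constants) recursions).

No definition, no sorry.  RECORD-rung R3 plumbing (fixed cut-off); nothing here bears on the Yang–Mills mass gap.
-/

set_option autoImplicit false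

noncomputable section

namespace Summit.QuantumFields.YangMills.Theorems.ColdStartUniversality

open MeasureTheory ProbabilityTheory Filter Topology Set
open scoped NNReal

/-! ## Bounds and uniform continuity on compact spaces -/

/-- A continuous real function on a compact space is bounded: `∃ M ≥ 0, ∀ y, |f y| ≤ M`. [folklore] -/
theorem exists_abs_le_of_continuous_of_compactSpace {Y : Type*} [TopologicalSpace Y] [CompactSpace Y]
    {f : Y → ℝ} (hf : Continuous f) : ∃ M : ℝ, 0 ≤ M ∧ ∀ y, |f y| ≤ M := by
  rcases isEmpty_or_nonempty Y with hY | hY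
  · exact ⟨0, le_rfl, fun y => (IsEmpty.false y).elim⟩
  · obtain ⟨y₀, -, hy₀⟩ := isCompact_univ.exists_isMaxOn univ_nonempty hf.abs.continuousOn
    exact ⟨|f y₀|, abs_nonneg _, fun y => hy₀ (mem_univ y)⟩

/-- A continuous positive function on a compact space is bounded below by a positive constant. [folklore] -/
theorem exists_pos_le_of_continuous_of_compactSpace {Y : Type*} [TopologicalSpace Y] [CompactSpace Y]
    {f : Y → ℝ} (hf : Continuous f) (hpos : ∀ y, 0 < f y) : ∃ c : ℝ, 0 < c ∧ ∀ y, c ≤ f y := by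
  rcases isEmpty_or_nonempty Y with hY | hY
  · exact ⟨1, one_pos, fun y => (IsEmpty.false y).elim⟩
  · obtain ⟨y₀, -, hy₀⟩ := isCompact_univ.exists_isMinOn univ_nonempty hf.continuousOn
    exact ⟨f y₀, hpos y₀, fun y => hy₀ (mem_univ y)⟩

/-- **Tube lemma, sup-norm form.**  A jointly continuous `F : P → Y → ℝ` with `Y` compact tends to `F p₀` UNIFORMLY on `Y`
as `p → p₀` (the curried map `P → C(Y, ℝ)` is continuous for the compact-open = uniform topology). [folklore] -/
theorem tendstoUniformly_of_continuous_uncurry {P Y : Type*} [TopologicalSpace P] [TopologicalSpace Y] [CompactSpace Y]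
    {F : P → Y → ℝ} (hF : Continuous (Function.uncurry F)) (p₀ : P) :
    TendstoUniformly F (F p₀) (𝓝 p₀) := by
  let f : P → C(Y, ℝ) := fun p => ⟨F p, hF.comp (continuous_const.prodMk continuous_id)⟩
  have hf : Continuous f := ContinuousMap.continuous_of_continuous_uncurry f hF
  have h := hf.tendsto p₀
  rw [ContinuousMap.tendsto_iff_tendstoUniformly] at h
  exact h

/-- Metric form of `tendstoUniformly_of_continuous_uncurry`: for every `ε > 0`, eventually in `p → p₀`,
`|F p y - F p₀ y| < ε` for ALL `y`. [folklore] -/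
theorem eventually_forall_abs_sub_lt_of_continuous_uncurry {P Y : Type*} [TopologicalSpace P] [TopologicalSpace Y]
    [CompactSpace Y] {F : P → Y → ℝ} (hF : Continuous (Function.uncurry F)) (p₀ : P) {ε : ℝ} (hε : 0 < ε) :
    ∀ᶠ p in 𝓝 p₀, ∀ y, |F p y - F p₀ y| < ε := by
  have h := Metric.tendstoUniformly_iff.1 (tendstoUniformly_of_continuous_uncurry hF p₀) ε hε
  refine h.mono fun p hp y => ?_
  rw [← Real.dist_eq, dist_comm]
  exact hp y

/-! ## Markov-kernel actions -/

/-- `|∫ f dμ| ≤ M` for a probability measure and `|f| ≤ M` pointwise. [folklore] -/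
theorem abs_integral_le_of_abs_le_of_isProbabilityMeasure {Y : Type*} [MeasurableSpace Y] {μ : Measure Y}
    [IsProbabilityMeasure μ] {f : Y → ℝ} {M : ℝ} (hf : ∀ y, |f y| ≤ M) : |∫ y, f y ∂μ| ≤ M := by
  have h := norm_integral_le_of_norm_le_const (μ := μ) (f := f) (C := M)
    (Eventually.of_forall fun y => by rw [Real.norm_eq_abs]; exact hf y)
  rwa [Real.norm_eq_abs, probReal_univ, mul_one] at h

/-- A continuous real function on a compact Borel space is integrable for every finite measure. [folklore] -/
theorem integrable_of_continuous_of_compactSpace {Y : Type*} [TopologicalSpace Y] [CompactSpace Y] [MeasurableSpace Y]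
    [OpensMeasurableSpace Y] {f : Y → ℝ} (hf : Continuous f) (μ : Measure Y) [IsFiniteMeasure μ] : Integrable f μ := by
  obtain ⟨M, -, hM⟩ := exists_abs_le_of_continuous_of_compactSpace hf
  exact Integrable.of_bound hf.measurable.aestronglyMeasurable M
    (Eventually.of_forall fun y => by rw [Real.norm_eq_abs]; exact hM y)

/-- `|∫ f dμ - ∫ g dμ| ≤ ε` for a probability measure and continuous `f, g` on a compact space with `|f - g| ≤ ε`.
[folklore] -/
theorem abs_integral_sub_integral_le_of_abs_sub_le {Y : Type*} [TopologicalSpace Y] [CompactSpace Y] [MeasurableSpace Y]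
    [OpensMeasurableSpace Y] {μ : Measure Y} [IsProbabilityMeasure μ] {f g : Y → ℝ} (hf : Continuous f) (hg : Continuous g)
    {ε : ℝ} (h : ∀ y, |f y - g y| ≤ ε) : |(∫ y, f y ∂μ) - ∫ y, g y ∂μ| ≤ ε := by
  rw [← integral_sub (integrable_of_continuous_of_compactSpace hf μ) (integrable_of_continuous_of_compactSpace hg μ)]
  exact abs_integral_le_of_abs_le_of_isProbabilityMeasure h

/-- **Jointly continuous kernel actions compose with jointly continuous families.**  If for every continuous `G` the
action `(s, x) ↦ ∫ G d(κ s x)` of the Markov-kernel family `κ` is jointly continuous, then for every jointly continuous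
family `(p, y) ↦ G p y` (compact `X`) the map `(s, p, x) ↦ ∫ G p d(κ s x)` is jointly continuous. [folklore] -/
theorem continuous_kernel_action_comp {X P : Type*} [TopologicalSpace X] [CompactSpace X] [MeasurableSpace X]
    [OpensMeasurableSpace X] [TopologicalSpace P] (κ : ℝ≥0 → Kernel X X) [∀ t, IsMarkovKernel (κ t)]
    (hK : ∀ G : X → ℝ, Continuous G → Continuous fun p : ℝ≥0 × X => ∫ y, G y ∂(κ p.1 p.2))
    {G : P → X → ℝ} (hG : Continuous (Function.uncurry G)) :
    Continuous fun q : ℝ≥0 × P × X => ∫ y, G q.2.1 y ∂(κ q.1 q.2.2) := by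
  have hGp : ∀ p, Continuous (G p) := fun p => hG.comp (continuous_const.prodMk continuous_id)
  refine continuous_iff_continuousAt.2 fun q₀ => ?_
  obtain ⟨s₀, p₀, x₀⟩ := q₀
  refine Metric.tendsto_nhds.2 fun ε hε => ?_
  -- uniform closeness of `G p` to `G p₀`
  have h1 : ∀ᶠ q : ℝ≥0 × P × X in 𝓝 (s₀, p₀, x₀), ∀ y, |G q.2.1 y - G p₀ y| < ε / 2 := by
    have hc : ContinuousAt (fun q : ℝ≥0 × P × X => q.2.1) (s₀, p₀, x₀) :=
      (continuous_fst.comp continuous_snd).continuousAt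
    exact hc.eventually (eventually_forall_abs_sub_lt_of_continuous_uncurry hG p₀ (half_pos hε))
  -- continuity of the action on the fixed function `G p₀`
  have h2 : ∀ᶠ q : ℝ≥0 × P × X in 𝓝 (s₀, p₀, x₀),
      dist (∫ y, G p₀ y ∂(κ q.1 q.2.2)) (∫ y, G p₀ y ∂(κ s₀ x₀)) < ε / 2 := by
    have hc : Continuous fun q : ℝ≥0 × P × X => ∫ y, G p₀ y ∂(κ q.1 q.2.2) :=
      (hK (G p₀) (hGp p₀)).comp (continuous_fst.prodMk (continuous_snd.comp continuous_snd))
    exact Metric.tendsto_nhds.1 (hc.tendsto (s₀, p₀, x₀)) (ε / 2) (half_pos hε)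
  filter_upwards [h1, h2] with q hq1 hq2
  have h3 : |(∫ y, G q.2.1 y ∂(κ q.1 q.2.2)) - ∫ y, G p₀ y ∂(κ q.1 q.2.2)| ≤ ε / 2 :=
    abs_integral_sub_integral_le_of_abs_sub_le (hGp _) (hGp p₀) fun y => (hq1 y).le
  rw [Real.dist_eq] at hq2 ⊢
  calc |(∫ y, G q.2.1 y ∂(κ q.1 q.2.2)) - ∫ y, G p₀ y ∂(κ s₀ x₀)|
      ≤ |(∫ y, G q.2.1 y ∂(κ q.1 q.2.2)) - ∫ y, G p₀ y ∂(κ q.1 q.2.2)| +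
          |(∫ y, G p₀ y ∂(κ q.1 q.2.2)) - ∫ y, G p₀ y ∂(κ s₀ x₀)| := abs_sub_le _ _ _
    _ < ε / 2 + ε / 2 := add_lt_add_of_le_of_lt h3 hq2
    _ = ε := add_halves ε

/-- Real-time form of `continuous_kernel_action_comp`: with a continuous time change `τ : P → ℝ` (read through `Real.toNNReal`),
`(p, x) ↦ ∫ G p d(κ (τ p)⁺ x)` is jointly continuous. [folklore] -/
theorem continuous_kernel_action_comp_real {X P : Type*} [TopologicalSpace X] [CompactSpace X] [MeasurableSpace X]
    [OpensMeasurableSpace X] [TopologicalSpace P] (κ : ℝ≥0 → Kernel X X) [∀ t, IsMarkovKernel (κ t)]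
    (hK : ∀ G : X → ℝ, Continuous G → Continuous fun p : ℝ≥0 × X => ∫ y, G y ∂(κ p.1 p.2))
    {G : P → X → ℝ} (hG : Continuous (Function.uncurry G)) {τ : P → ℝ} (hτ : Continuous τ) :
    Continuous fun q : P × X => ∫ y, G q.1 y ∂(κ (τ q.1).toNNReal q.2) := by
  have h := continuous_kernel_action_comp κ hK hG
  exact h.comp ((continuous_real_toNNReal.comp (hτ.comp continuous_fst)).prodMk
    (continuous_fst.prodMk continuous_snd))

/-! ## Interchanging a finite measure with a time integral -/

/-- **`∫ (∫ₐᵇ G u y du) dν(y) = ∫ₐᵇ (∫ G u y dν(y)) du`** for a finite measure `ν` on a compact space and a jointly continuous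
`G` (bounded on `[a, b] × X`, so Fubini applies). [folklore] -/
theorem integral_intervalIntegral_swap_of_continuous {X : Type*} [TopologicalSpace X] [CompactSpace X] [MeasurableSpace X]
    [OpensMeasurableSpace X] (ν : Measure X) [IsFiniteMeasure ν] {G : ℝ → X → ℝ} (hG : Continuous (Function.uncurry G))
    {a b : ℝ} (hab : a ≤ b) :
    ∫ y, (∫ u in a..b, G u y) ∂ν = ∫ u in a..b, (∫ y, G u y ∂ν) := by
  -- a uniform bound on the compact `[a, b] × X`
  obtain ⟨M, hM⟩ : ∃ M : ℝ, ∀ u ∈ Icc a b, ∀ y : X, |G u y| ≤ M := by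
    have hc : IsCompact ((Icc a b) ×ˢ (univ : Set X)) := isCompact_Icc.prod isCompact_univ
    obtain ⟨M, hM⟩ := hc.bddAbove_image hG.abs.continuousOn
    exact ⟨M, fun u hu y => hM ⟨(u, y), ⟨hu, mem_univ y⟩, rfl⟩⟩
  set μ : Measure ℝ := volume.restrict (Ioc a b) with hμ
  haveI : IsFiniteMeasure μ := by rw [hμ]; infer_instance
  have hmeas : AEStronglyMeasurable (Function.uncurry fun (y : X) (u : ℝ) => G u y) (ν.prod μ) :=
    (hG.comp continuous_swap).stronglyMeasurable.aestronglyMeasurable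
  have hae : ∀ᵐ p : X × ℝ ∂(ν.prod μ), p ∈ {p : X × ℝ | p.2 ∈ Ioc a b} := by
    have hs : MeasurableSet {p : X × ℝ | p.2 ∈ Ioc a b} := measurableSet_Ioc.preimage measurable_snd
    rw [Measure.ae_prod_mem_iff_ae_ae_mem hs]
    exact Eventually.of_forall fun y => by rw [hμ]; exact ae_restrict_mem measurableSet_Ioc
  have hint : Integrable (Function.uncurry fun (y : X) (u : ℝ) => G u y) (ν.prod μ) := by
    refine Integrable.of_bound hmeas M (hae.mono fun p hp => ?_)
    rw [Real.norm_eq_abs]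
    exact hM p.2 (Ioc_subset_Icc_self hp) p.1
  have h := integral_integral_swap hint
  simp only [intervalIntegral.integral_of_le hab]
  exact h

/-! ## Fubini on the 2-simplex and the shear substitution -/

/-- **Fubini on the 2-simplex** for interval integrals of a jointly continuous `f`:
`∫₀ᵗ (∫₀ʳ f r u du) dr = ∫₀ᵗ (∫ᵤᵗ f r u dr) du`. [folklore] -/
theorem intervalIntegral_triangle_swap {f : ℝ → ℝ → ℝ} (hf : Continuous (Function.uncurry f)) {t : ℝ} (ht : 0 ≤ t) :
    ∫ r in (0 : ℝ)..t, (∫ u in (0 : ℝ)..r, f r u) = ∫ u in (0 : ℝ)..t, (∫ r in u..t, f r u) := by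
  -- the integrand extended by zero off the simplex
  set g : ℝ → ℝ → ℝ := fun r u => indicator {u | u ≤ r} (f r) u with hg
  -- a uniform bound on `[0, t]²`
  obtain ⟨M, hM⟩ : ∃ M : ℝ, ∀ r ∈ Icc (0 : ℝ) t, ∀ u ∈ Icc (0 : ℝ) t, |f r u| ≤ M := by
    have hc : IsCompact ((Icc (0 : ℝ) t) ×ˢ (Icc (0 : ℝ) t)) := isCompact_Icc.prod isCompact_Icc
    obtain ⟨M, hM⟩ := hc.bddAbove_image hf.abs.continuousOn
    exact ⟨M, fun r hr u hu => hM ⟨(r, u), ⟨hr, hu⟩, rfl⟩⟩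
  have hM0 : 0 ≤ M := (abs_nonneg _).trans (hM 0 (left_mem_Icc.2 ht) 0 (left_mem_Icc.2 ht))
  set μ : Measure ℝ := volume.restrict (Ioc (0 : ℝ) t) with hμ
  haveI : IsFiniteMeasure μ := by rw [hμ]; infer_instance
  -- step 1: the inner `u`-integral as an integral over `[0, t]`
  have h1 : ∀ r ∈ Icc (0 : ℝ) t, ∫ u in (0 : ℝ)..r, f r u = ∫ u in (0 : ℝ)..t, g r u := by
    intro r hr
    rw [hg]
    exact (intervalIntegral.integral_indicator (μ := volume) (f := f r) hr).symm
  -- step 3: the inner `r`-integral as an integral over `[0, t]`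
  have h3 : ∀ u ∈ Ioc (0 : ℝ) t, ∫ r in u..t, f r u = ∫ r in (0 : ℝ)..t, g r u := by
    intro u hu
    have hgu : (fun r => g r u) = indicator (Ici u) (fun r => f r u) := by
      funext r
      by_cases hur : u ≤ r
      · simp [hg, indicator, hur]
      · simp [hg, indicator, hur]
    rw [hgu, intervalIntegral.integral_of_le hu.2, intervalIntegral.integral_of_le (hu.1.le.trans hu.2),
      integral_indicator measurableSet_Ici, Measure.restrict_restrict measurableSet_Ici]
    have hset : Ici u ∩ Ioc 0 t = Icc u t := by
      ext r
      simp only [mem_inter_iff, mem_Ici, mem_Ioc, mem_Icc]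
      constructor
      · rintro ⟨h1, -, h2⟩; exact ⟨h1, h2⟩
      · rintro ⟨h1, h2⟩; exact ⟨h1, hu.1.trans_le h1, h2⟩
    rw [hset, integral_Icc_eq_integral_Ioc]
  -- step 2: Fubini on the square
  have hgm : Measurable (Function.uncurry g) := by
    have hs : MeasurableSet {p : ℝ × ℝ | p.2 ≤ p.1} := measurableSet_le measurable_snd measurable_fst
    have : Function.uncurry g = indicator {p : ℝ × ℝ | p.2 ≤ p.1} (Function.uncurry f) := by
      funext p
      by_cases hp : p.2 ≤ p.1
      · simp [Function.uncurry, hg, indicator, hp]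
      · simp [Function.uncurry, hg, indicator, hp]
    rw [this]
    exact hf.measurable.indicator hs
  have hgb : ∀ r ∈ Icc (0 : ℝ) t, ∀ u ∈ Icc (0 : ℝ) t, |g r u| ≤ M := by
    intro r hr u hu
    simp only [hg, indicator, mem_setOf_eq]
    split_ifs
    · exact hM r hr u hu
    · rw [abs_zero]; exact hM0
  have hae : ∀ᵐ p : ℝ × ℝ ∂(μ.prod μ), p ∈ {p : ℝ × ℝ | p.1 ∈ Ioc (0 : ℝ) t ∧ p.2 ∈ Ioc (0 : ℝ) t} := by
    have hs : MeasurableSet {p : ℝ × ℝ | p.1 ∈ Ioc (0 : ℝ) t ∧ p.2 ∈ Ioc (0 : ℝ) t} :=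
      (measurableSet_Ioc.preimage measurable_fst).inter (measurableSet_Ioc.preimage measurable_snd)
    rw [Measure.ae_prod_mem_iff_ae_ae_mem hs]
    rw [hμ]
    filter_upwards [ae_restrict_mem measurableSet_Ioc] with r hr
    filter_upwards [ae_restrict_mem measurableSet_Ioc] with u hu
    exact ⟨hr, hu⟩
  have hint : Integrable (Function.uncurry g) (μ.prod μ) := by
    refine Integrable.of_bound hgm.aestronglyMeasurable M (hae.mono fun p hp => ?_)
    rw [Real.norm_eq_abs]
    exact hgb p.1 (Ioc_subset_Icc_self hp.1) p.2 (Ioc_subset_Icc_self hp.2)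
  have h2 : ∫ r, ∫ u, g r u ∂μ ∂μ = ∫ u, ∫ r, g r u ∂μ ∂μ := integral_integral_swap hint
  -- assemble
  calc ∫ r in (0 : ℝ)..t, (∫ u in (0 : ℝ)..r, f r u)
      = ∫ r in (0 : ℝ)..t, (∫ u in (0 : ℝ)..t, g r u) :=
        intervalIntegral.integral_congr fun r hr => h1 r (by rwa [uIcc_of_le ht] at hr)
    _ = ∫ r, ∫ u, g r u ∂μ ∂μ := by
        rw [intervalIntegral.integral_of_le ht]
        exact setIntegral_congr_fun measurableSet_Ioc fun r _ => intervalIntegral.integral_of_le ht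
    _ = ∫ u, ∫ r, g r u ∂μ ∂μ := h2
    _ = ∫ u in (0 : ℝ)..t, (∫ r in (0 : ℝ)..t, g r u) := by
        rw [intervalIntegral.integral_of_le ht]
        exact (setIntegral_congr_fun measurableSet_Ioc fun u _ => intervalIntegral.integral_of_le ht).symm
    _ = ∫ u in (0 : ℝ)..t, (∫ r in u..t, f r u) := by
        rw [intervalIntegral.integral_of_le ht, intervalIntegral.integral_of_le ht]
        exact setIntegral_congr_fun measurableSet_Ioc fun u hu => (h3 u hu).symm

/-- **The shear substitution on the 2-simplex.**  For a jointly continuous `h : ℝ × ℝ × ℝ → ℝ` and `t ≥ 0`: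
`∫₀ᵗ ∫₀ʳ h (t - r) u (r - u) du dr = ∫₀ᵗ ∫₀ˢ h (s - u) u (t - s) du ds` — the volume-preserving shear
`(r, u) ↦ (t - r + u, u)` maps the simplex `{0 < u < r < t}` onto `{0 < u < s < t}` and exchanges the gaps
`(t - r, r - u) ↔ (s - u, t - s)`. [folklore] -/
theorem intervalIntegral_shear {h : ℝ → ℝ → ℝ → ℝ} (hh : Continuous fun p : ℝ × ℝ × ℝ => h p.1 p.2.1 p.2.2)
    {t : ℝ} (ht : 0 ≤ t) :
    ∫ r in (0 : ℝ)..t, (∫ u in (0 : ℝ)..r, h (t - r) u (r - u)) =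
      ∫ s in (0 : ℝ)..t, (∫ u in (0 : ℝ)..s, h (s - u) u (t - s)) := by
  have hf1 : Continuous (Function.uncurry fun r u : ℝ => h (t - r) u (r - u)) :=
    hh.comp ((continuous_const.sub continuous_fst).prodMk (continuous_snd.prodMk (continuous_fst.sub continuous_snd)))
  have hf2 : Continuous (Function.uncurry fun s u : ℝ => h (s - u) u (t - s)) :=
    hh.comp ((continuous_fst.sub continuous_snd).prodMk (continuous_snd.prodMk (continuous_const.sub continuous_fst)))
  rw [intervalIntegral_triangle_swap hf1 ht, intervalIntegral_triangle_swap hf2 ht]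
  refine intervalIntegral.integral_congr fun u _ => ?_
  have hsub := intervalIntegral.integral_comp_sub_left (fun s : ℝ => h (s - u) u (t - s)) (t + u) (a := u) (b := t)
  have e1 : t + u - t = u := by ring
  have e2 : t + u - u = t := by ring
  rw [e1, e2] at hsub
  rw [← hsub]
  refine intervalIntegral.integral_congr fun r _ => ?_
  show h (t - r) u (r - u) = h (t + u - r - u) u (t - (t + u - r))
  congr 1 <;> ring

end Summit.QuantumFields.YangMills.Theorems.ColdStartUniversality

end
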